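import Summits.QuantumFields.YangMills.Theorems.BalabanUVNodesN11AllSmallEmptyExt
import Summits.QuantumFields.YangMills.Theorems.BalabanUVNodesN20ChiSemanticsCubes

/-!
# DAG node N11 — HISTORY (A) IS NON-VACUOUS ON THE UNIT BRANCH: at a coarse field `V′` near which def-R's (2.12) local problem has NO minimiser on any
# χ_{k+1}-cube (e.g. `V′` `2εreg`-rough near every cube, `εreg` in [B7] Prop. 2's range), every (3.2) factor is `1` and, at the fine field `U := M^k(1)`, every
# (3.3) factor is `1` — so p538518's `w_k(s′_A)(U, V′) = 0` holds THERE, while p534515's `w_k(s′_B)(U, V′) = 1`: the two-history obstruction at an explicit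
# configuration class, not only under displayed smallness hypotheses

Cell `pub-ymgap`, YM-PLAN Track A (HUMAN RULING D-0062), seat `pub-ymgap-dag-n11-d` (g8; R134 fan-out seat N11 [B14], strategy s2), route `BalabanUVNodes`
rev 25, item K1⁷ `StabilityBAtRecordR13SepCoPH` = stmt-QuantumFields-20542 (helper, count-neutral).  [III] = [Balaban1988Convergent], [B7] = [Balaban1985Averaging].
Sequel of `…N11AllSmallEmptyExt` (p538518: director-ym №183 gate (g2)(A)) over dag-n20-c's `…N20ChiSemantics(Cubes)` (the (2.16) local problem of record is
solvable only at locally regular data — `dist1_plaqHol_lt_of_solvable`, level-generic; off the solvable set def-R's localized background is the UNIT configuration —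
`ukBox_eq_one_of_not_solvable`, `chiSmall_ukBox_eq_one_of_not_solvable`) and this seat's g5 `…N11NoExpansionUnitBranch` (the same at the first step).

WHY THIS FILE.  p538518 states history (A)'s vanishing under the displayed smallness hypotheses `h32` (every (3.2) factor `= 1` at `V′`) and `h33` (every (3.3)
factor `= 1` at `(U, V′)`), whose realisation passes through def-R's classical (2.12) backgrounds (referee A2∕A6 concern: not exhibited).  They ARE realised on the
documented UNIT BRANCH of `Node00.UminOfRecord`: if the (2.12) problem on `□′^{∼4}` has no minimiser at `V′` for every χ_{k+1}-cube `□′`, the localized background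
`U_{k+1,□′}(V′)` is `1`, so (i) its plaquette variables are `1` and the (3.2) indicator is `1` (`0 < ε_{k+1}η²`), and (ii) `V^{(k)}_{□′} = M^k(U_{k+1,□′}) = M^k(1)` is
ONE field `U⋆` for all cubes, whence at the fine field `U := U⋆` every (3.3) fluctuation `U(b)·V^{(k)}_{□′}(b)⁻¹ = 1` is `2δ_k`-small (`0 < δ_k`).  Non-solvability
at every cube follows from `2εreg`-ROUGHNESS of `V′` near every cube when `εreg` lies in [B7] Prop. 2's range (n20-c's solvability ⇒ regularity, level-generic;
g5's first-step argument verbatim one level up).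

WHAT THIS FILE PROVES (0 `sorry`, 0 `def`, standard axioms; `N`-generic; every run, `k`, `A₁`, residual `ζ`).  §1 `chiFactor_eq_one_of_not_solvable` ·
`smallApproxFluct_iterOne_of_not_solvable` · `not_solvable_of_roughAt` (level `k+1`; `εreg` in Prop. 2's range, grid `3·L^{k+1}M₁ ≤ sideχ`, `1 ≤ M₁`,
`k+1 ≤ m+K`).  §2 ★ `wOfRecord_allSmall_emptyExt_iterOne_eq_zero_of_not_solvable` (history (A): `w_k(s′)(M^k(1), V′) = 0` on the unit branch) ·
★ `…_of_cubeRough` (… at every `V′` `2εreg`-rough near every χ_{k+1}-cube) · ★★ `wOfRecord_two_histories_of_cubeRough` (with p534515: `1` on (B), `0` on (A) at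
the SAME `(k ≥ 1, Ω_{k+1} = ∅, M^k(1), V′)`).

HONEST FRAMING ∕ A6 (director-ym №189 (3)).  Kernel bookkeeping (count-neutral); the remaining binder `hV` (a coarse field of level `k+1 ≥ 2` with a `2εreg`-rough
plaquette cornered in `pts (k+1) (□′^{∼3})` for every χ_{k+1}-cube) is DISPLAYED — its level-1 inhabitant is this seat's g5 D1∕D2 (`Node00/CubeRoughSection` §2–§3,
level-generic alternating field; `…N11SmallRegFirstStepFails` §2, the level-1 cornering geometry); the level-`(k+1)` cornering is not typed here.  `εreg` in
Prop. 2's range EXCLUDES the witness of record (`εreg = 1`); nothing of Bałaban's is asserted (the unit branch is def-R's typing convention off the (2.12) class,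
not print's).  N11 NOT discharged; K1⁷ NOT closed; counts unmoved (typed 28∕28 · discharged 5∕28).  One finite four-torus programme at fixed `ε = L^{−K}`; NOT ℝ⁴,
NOT OS, NOT a mass gap, NOT Clay.  Sources: [III] (2.12)–(2.13) pp.256–257, (2.16)–(2.17) p.257, (3.2)–(3.5) p.265, p.267; [B7] Prop. 2 (52)–(54) p.26, (10) p.19.
-/

noncomputable section

open scoped BigOperators Matrix.Norms.L2Operator

namespace Summit.QuantumFields.YangMills.Theorems.BalabanUVNodesN11AllSmallEmptyExtUnitBranch

open Literature.MathematicalPhysics.QuantumFieldTheory.Balaban1983to89 T4Continuum Node00 Node00.Tk DagBinding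
open Literature.MathematicalPhysics.QuantumFieldTheory.Balaban1983to89.ExpMeanLog (deltaSU)
open Literature.MathematicalPhysics.QuantumFieldTheory.BalabanImbrieJaffe1984to88.BIJ85Eq453GaugeField (qsstarGIter0)
open B15DeterminingSets (pts IsMinimizer avgFamily)
open B14.Eq213DetSet (Bj maxDomT)
open B14.Eq216Concrete (ukBox)
open B14.Eq213MaximalDomains (side)
open B14.Sect3Decomp
open GaugeField (plaqHol)
open Summit.QuantumFields.YangMills.BalabanUVNodes.N20ChiSemantics (dist1_plaqHol_lt_of_solvable chiSmall_ukBox_eq_one_of_not_solvable ukBox_eq_one_of_not_solvable)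
open Summit.QuantumFields.YangMills.BalabanUVNodes.N20ChiSemanticsCubes (pts_cubeEnl_subset)
open BalabanUVNodesN11AllSmallEmptyExt (wOfRecord_allSmall_emptyExt_eq_zero_of_small)
open BalabanUVNodesN11DiagonalPinAboveZero (wOfRecord_seqAllLarge_succ_eq_one)

variable {F : T4Family} {N : ℕ} [NeZero N]

/-! ## §1. The unit branch at level `k+1`: (3.2) and (3.3) factors are `1`; roughness forces it -/

section UnitBranch

variable (ν : Stage7Numerics) (M : ℕ) (A₁ : ℝ) (p : B12.RunParams) (g : ℕ → ℝ) (k : ℕ)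

/-- **NO (2.12) MINIMISER ON `□′^{∼4}` AT `V′` ⇒ THE (3.2) FACTOR OF `□′` IS `1`** (def-R's localized background is the unit configuration; `0 < ε_{k+1}η_{k+1}²`).
[cite: Balaban1988Convergent, (2.12) p.256, (2.16)–(2.17) p.257, (3.2) p.265] -/
theorem chiFactor_eq_one_of_not_solvable (hε₁ : 0 < epsOfRecord ν g (k + 1) * (F.P p.K).eta (k + 1) ^ 2) (c : Iχ F ν p g k)
    (V' : GaugeField (F.P p.K) (k + 1) (SU N))
    (hns : ¬ ∃ U₀, IsMinimizer (avOfRecord F N p.K) {U | PlaqSmall (ν.εreg * (F.P p.K).eta (k + 1) ^ 2) U}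
      (Bj ν.M₁ (cubeEnl (F.P p.K) (sideχ F ν p g k) c 4) (k + 1)) (avgFamily (avOfRecord F N p.K) (qsstarGIter0 (k + 1) V')) U₀) :
    chiFactor F N ν p g k c V' = 1 :=
  chiSmall_ukBox_eq_one_of_not_solvable _ hε₁ hns

/-- **NO (2.12) MINIMISER AT `V′` ON ANY CUBE ⇒ AT THE FINE FIELD `U⋆ := M^k(1)` EVERY (3.3) CONDITION HOLDS**: `V^{(k)}_{□′}(V′) = M^k(U_{k+1,□′}(V′)) = M^k(1) = U⋆`
for every `□′`, so `U⋆(b)·V^{(k)}_{□′}(b)⁻¹ = 1` and its distance to `1` is `0 < 2δ_k`. [cite: Balaban1988Convergent, (3.3)–(3.4) p.265, (2.16) p.257] -/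
theorem smallApproxFluct_iterOne_of_not_solvable (hδ : 0 < 2 * deltaOfRecord ν g k A₁) (s : SeqOfRecord F ν M g p.K k) (c : Iχ F ν p g k)
    (V' : GaugeField (F.P p.K) (k + 1) (SU N))
    (hns : ¬ ∃ U₀, IsMinimizer (avOfRecord F N p.K) {U | PlaqSmall (ν.εreg * (F.P p.K).eta (k + 1) ^ 2) U}
      (Bj ν.M₁ (cubeEnl (F.P p.K) (sideχ F ν p g k) c 4) (k + 1)) (avgFamily (avOfRecord F N p.K) (qsstarGIter0 (k + 1) V')) U₀) :
    SmallApproxFluct (sect3DataOfRecord F N ν M p g k s) (avOfRecord F N p.K) (2 * deltaOfRecord ν g k A₁)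
      (Averaging.iter (avOfRecord F N p.K) k (fun _ => 1)) V' c := by
  intro b _
  show dist1 (Averaging.iter (avOfRecord F N p.K) k (fun _ => 1) b *
      (Averaging.iter (avOfRecord F N p.K) k
        (ukBox (bgOfRecord (avOfRecord F N p.K) {U | PlaqSmall (ν.εreg * (F.P p.K).eta (k + 1) ^ 2) U}) ν.M₁
          (cubeEnl (F.P p.K) (sideχ F ν p g k) c 4) (k + 1) V') b)⁻¹) < 2 * deltaOfRecord ν g k A₁
  rw [ukBox_eq_one_of_not_solvable hns, mul_inv_cancel, GaugeGroup.dist1_one]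
  exact hδ

/-- **A `2εreg`-ROUGH PLAQUETTE CORNERED IN `pts (k+1) (□′^{∼3})` RULES OUT EVERY (2.12) MINIMISER ON `□′^{∼4}`** (`εreg` in [B7] Prop. 2's range, grid
`3·L^{k+1}M₁ ≤ sideχ`, `1 ≤ M₁`, `k+1 ≤ m+K`): dag-n20-c's solvability ⇒ local regularity (`dist1 < 2εreg` on the cornered plaquettes), contraposed — g5's
first-step lemma one level up. [cite: Balaban1988Convergent, (2.12)–(2.13) pp.256–257; Balaban1985Averaging, Prop. 2 (52)–(54) p.26] -/
theorem not_solvable_of_roughAt (hmK : k + 1 ≤ (F.P p.K).m + (F.P p.K).K) (hε : 0 < ν.εreg)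
    (hε3 : (143 * (((((F.P p.K).d + 4 : ℕ) : ℝ)) ^ 2 / 4) ^ 2) * ν.εreg ≤ 1 / 3)
    (hε2 : 2 * ν.εreg ≤ 2 * deltaSU (Fin N) / ((((F.P p.K).d + 4) * (F.P p.K).L : ℕ) : ℝ) ^ 2)
    (hM : 1 ≤ ν.M₁) (h3 : 3 * side (F.P p.K).L ν.M₁ (k + 1) ≤ sideχ F ν p g k)
    (c : Iχ F ν p g k) (V' : GaugeField (F.P p.K) (k + 1) (SU N)) {q : Plaq (F.P p.K) (k + 1)}
    (h₀ : q.src ∈ pts (k + 1) (cubeEnl (F.P p.K) (sideχ F ν p g k) c 3))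
    (hμ : q.src.shift q.μ ∈ pts (k + 1) (cubeEnl (F.P p.K) (sideχ F ν p g k) c 3))
    (hν : q.src.shift q.ν ∈ pts (k + 1) (cubeEnl (F.P p.K) (sideχ F ν p g k) c 3)) (hrough : 2 * ν.εreg ≤ dist1 (plaqHol V' q)) :
    ¬ ∃ U₀, IsMinimizer (avOfRecord F N p.K) {U | PlaqSmall (ν.εreg * (F.P p.K).eta (k + 1) ^ 2) U}
      (Bj ν.M₁ (cubeEnl (F.P p.K) (sideχ F ν p g k) c 4) (k + 1)) (avgFamily (avOfRecord F N p.K) (qsstarGIter0 (k + 1) V')) U₀ := by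
  intro hsolv
  have hsub := pts_cubeEnl_subset (F.P p.K) hM (k := k + 1) h3 (c : B14DomainGeom.Pt (F.P p.K).d) 3
  exact absurd (dist1_plaqHol_lt_of_solvable (F := F) (N := N) hmK hε hε3 hε2 hsolv q (hsub h₀) (hsub hμ) (hsub hν)) (not_lt.2 hrough)

end UnitBranch

/-! ## §2. ★ History (A) vanishes on the unit branch at `U⋆ = M^k(1)`; the two-history obstruction at an explicit configuration class -/

section HistoryA

variable (ν : Stage7Numerics) (M : ℕ) (A₁ : ℝ) (p : B12.RunParams) (g : ℕ → ℝ) (k : ℕ)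

/-- **★ HISTORY (A) ON THE UNIT BRANCH**: for a new sequence `s′` with `Ω_{k+1}(s′) = ∅` over an all-small old term (`Λ_k = T`; `k = 0`: no condition) and a coarse
field `V′` at which NO χ_{k+1}-cube's (2.12) problem is solvable, `w_k(s′)(M^k(1), V′) = 0` — for EVERY residual `ζ` (`0 < ε_{k+1}η²`, `0 < δ_k`, `0 < sideD`).
[cite: Balaban1988Convergent, (3.2)–(3.5) p.265, (2.12) p.256, (2.16) p.257, p.267] -/
theorem wOfRecord_allSmall_emptyExt_iterOne_eq_zero_of_not_solvable (ζ : ZetaOfRecord F N ν M) (hD : 0 < sideD F ν M p g k)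
    (hε₁ : 0 < epsOfRecord ν g (k + 1) * (F.P p.K).eta (k + 1) ^ 2) (hδ : 0 < 2 * deltaOfRecord ν g k A₁)
    (s' : SeqOfRecord F ν M g p.K (k + 1)) (hΩ : s'.Ω (k + 1) = ∅) (hΛ : 1 ≤ k → s'.init.Λ k = Set.univ)
    (V' : GaugeField (F.P p.K) (k + 1) (SU N))
    (hns : ∀ c : Iχ F ν p g k, ¬ ∃ U₀, IsMinimizer (avOfRecord F N p.K) {U | PlaqSmall (ν.εreg * (F.P p.K).eta (k + 1) ^ 2) U}
      (Bj ν.M₁ (cubeEnl (F.P p.K) (sideχ F ν p g k) c 4) (k + 1)) (avgFamily (avOfRecord F N p.K) (qsstarGIter0 (k + 1) V')) U₀) :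
    wOfRecord F N ν M A₁ ζ p g k s' (Averaging.iter (avOfRecord F N p.K) k (fun _ => 1)) V' = 0 :=
  wOfRecord_allSmall_emptyExt_eq_zero_of_small F N ν M A₁ p g k ζ hD s' hΩ hΛ _ V'
    (fun c => chiFactor_eq_one_of_not_solvable ν p g k hε₁ c V' (hns c))
    (fun c => smallApproxFluct_iterOne_of_not_solvable ν M A₁ p g k hδ s'.init c V' (hns c))

/-- **★ … AT EVERY COARSE FIELD `2εreg`-ROUGH NEAR EVERY χ_{k+1}-CUBE** (`εreg` in [B7] Prop. 2's range, grid `3·L^{k+1}M₁ ≤ sideχ`, `1 ≤ M₁`, `k+1 ≤ m+K`).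
[cite: Balaban1988Convergent, (3.2)–(3.5) p.265, (2.12) p.256; Balaban1985Averaging, Prop. 2 (54) p.26] -/
theorem wOfRecord_allSmall_emptyExt_iterOne_eq_zero_of_cubeRough (ζ : ZetaOfRecord F N ν M) (hD : 0 < sideD F ν M p g k)
    (hε₁ : 0 < epsOfRecord ν g (k + 1) * (F.P p.K).eta (k + 1) ^ 2) (hδ : 0 < 2 * deltaOfRecord ν g k A₁)
    (hmK : k + 1 ≤ (F.P p.K).m + (F.P p.K).K) (hε : 0 < ν.εreg)
    (hε3 : (143 * (((((F.P p.K).d + 4 : ℕ) : ℝ)) ^ 2 / 4) ^ 2) * ν.εreg ≤ 1 / 3)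
    (hε2 : 2 * ν.εreg ≤ 2 * deltaSU (Fin N) / ((((F.P p.K).d + 4) * (F.P p.K).L : ℕ) : ℝ) ^ 2)
    (hM : 1 ≤ ν.M₁) (h3 : 3 * side (F.P p.K).L ν.M₁ (k + 1) ≤ sideχ F ν p g k)
    (s' : SeqOfRecord F ν M g p.K (k + 1)) (hΩ : s'.Ω (k + 1) = ∅) (hΛ : 1 ≤ k → s'.init.Λ k = Set.univ)
    (V' : GaugeField (F.P p.K) (k + 1) (SU N))
    (hV : ∀ c : Iχ F ν p g k, ∃ q : Plaq (F.P p.K) (k + 1),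
      q.src ∈ pts (k + 1) (cubeEnl (F.P p.K) (sideχ F ν p g k) c 3) ∧ q.src.shift q.μ ∈ pts (k + 1) (cubeEnl (F.P p.K) (sideχ F ν p g k) c 3) ∧
        q.src.shift q.ν ∈ pts (k + 1) (cubeEnl (F.P p.K) (sideχ F ν p g k) c 3) ∧ 2 * ν.εreg ≤ dist1 (plaqHol V' q)) :
    wOfRecord F N ν M A₁ ζ p g k s' (Averaging.iter (avOfRecord F N p.K) k (fun _ => 1)) V' = 0 :=
  wOfRecord_allSmall_emptyExt_iterOne_eq_zero_of_not_solvable ν M A₁ p g k ζ hD hε₁ hδ s' hΩ hΛ V' fun c => by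
    obtain ⟨q, h₀, hμ, hν, hr⟩ := hV c
    exact not_solvable_of_roughAt ν p g k hmK hε hε3 hε2 hM h3 c V' h₀ hμ hν hr

/-- **★★ THE TWO-HISTORY OBSTRUCTION AT AN EXPLICIT CONFIGURATION CLASS** (`k ≥ 1`, ζ-unity): at the fine field `M^k(1)` and ANY coarse field `2εreg`-rough near
every χ_{k+1}-cube (standing hypotheses as above), def-T's resummed step weight is `1` at the all-large-field history (B) (p534515) and `0` at the all-small-then-
`(∅,∅)` history (A), both sharing `Ω_{k+1} = ∅` — FINDING №9's kernel half without displayed smallness hypotheses on the configuration.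
[cite: Balaban1988Convergent, (3.2)–(3.5) p.265, (3.16) p.268, (3.20)–(3.21) p.269, p.267, (3.23) p.270; Balaban1985Averaging, Prop. 2 (54) p.26] -/
theorem wOfRecord_two_histories_of_cubeRough {ζ : ZetaOfRecord F N ν M} (hζ : IsZetaUnity F N ν M ζ) (hk : 1 ≤ k) (hD : 0 < sideD F ν M p g k)
    (hε₁ : 0 < epsOfRecord ν g (k + 1) * (F.P p.K).eta (k + 1) ^ 2) (hδ : 0 < 2 * deltaOfRecord ν g k A₁)
    (hmK : k + 1 ≤ (F.P p.K).m + (F.P p.K).K) (hε : 0 < ν.εreg)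
    (hε3 : (143 * (((((F.P p.K).d + 4 : ℕ) : ℝ)) ^ 2 / 4) ^ 2) * ν.εreg ≤ 1 / 3)
    (hε2 : 2 * ν.εreg ≤ 2 * deltaSU (Fin N) / ((((F.P p.K).d + 4) * (F.P p.K).L : ℕ) : ℝ) ^ 2)
    (hM : 1 ≤ ν.M₁) (h3 : 3 * side (F.P p.K).L ν.M₁ (k + 1) ≤ sideχ F ν p g k)
    (sA : SeqOfRecord F ν M g p.K (k + 1)) (hΩA : sA.Ω (k + 1) = ∅) (hΛA : sA.init.Λ k = Set.univ)
    (V' : GaugeField (F.P p.K) (k + 1) (SU N))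
    (hV : ∀ c : Iχ F ν p g k, ∃ q : Plaq (F.P p.K) (k + 1),
      q.src ∈ pts (k + 1) (cubeEnl (F.P p.K) (sideχ F ν p g k) c 3) ∧ q.src.shift q.μ ∈ pts (k + 1) (cubeEnl (F.P p.K) (sideχ F ν p g k) c 3) ∧
        q.src.shift q.ν ∈ pts (k + 1) (cubeEnl (F.P p.K) (sideχ F ν p g k) c 3) ∧ 2 * ν.εreg ≤ dist1 (plaqHol V' q)) :
    wOfRecord F N ν M A₁ ζ p g k (seqAllLargeOfRecord F ν M g p.K (k + 1)) (Averaging.iter (avOfRecord F N p.K) k (fun _ => 1)) V' = 1 ∧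
      wOfRecord F N ν M A₁ ζ p g k sA (Averaging.iter (avOfRecord F N p.K) k (fun _ => 1)) V' = 0 :=
  ⟨wOfRecord_seqAllLarge_succ_eq_one ν M A₁ p g hζ hk _ V',
    wOfRecord_allSmall_emptyExt_iterOne_eq_zero_of_cubeRough ν M A₁ p g k ζ hD hε₁ hδ hmK hε hε3 hε2 hM h3 sA hΩA (fun _ => hΛA) V' hV⟩

end HistoryA

end Summit.QuantumFields.YangMills.Theorems.BalabanUVNodesN11AllSmallEmptyExtUnitBranch

end
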